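import Literature.Topology.FourManifolds.LeeRasmussenProofs
import Literature.Topology.FourManifolds.KhHtpyEquiv
import HarnessLib

/-!
# Rasmussen's `s` along filtered homotopy equivalences of Lee complexes

Sibling file of `LeeRasmussen.lean` (programme towards the named fact
`GaussDiagram.rasmussenInvariant_eq_of_equiv`). The invariance of `s` under a Reidemeister move
rests on one piece of homological algebra (Rasmussen (2010), §6, proof of Thm. 1: "the maps
inducing the isomorphisms on Lee homology are filtered of degree `0`"): a homotopy equivalence
between the total Lee cochains of two Gauss diagrams (`GaussDiagram.HtpyEquiv` of `KhHtpyEquiv`,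
over `(ℚ, h = 0, t = 1)`), preserving the homological degree (homotopies lowering it by one) and
whose two chain maps **do not decrease the quantum filtration** (`QFiltered`), identifies `s_max`
and hence `s`:

* `QFiltered` — a linear map of total cochains sends each basis state to states of higher or
  equal quantum degree; closure under composition; the filtration degree `qMin` of a
  degree-zero chain does not decrease under such a map (`qMin_le_qMin_fDeg`);
* `HtpyEquiv.leeSMax_le_of_qFiltered` — `s_max(G) ≤ s_max(K)` when `F : C(G) → C(K)` is
  filtered (it is injective on homology by the homotopy `B F ≃ 1`, and `leeSMax_le_of_filtered`
  of `LeeRasmussenProofs` applies); `HtpyEquiv.symm`, `leeSMax_eq_of_qFiltered`,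
  `rasmussenInvariant_eq_of_qFiltered`;
* `HtpyData.toHtpyEquiv'` — a strong deformation retraction is a homotopy equivalence.

Everything is proved; no named fact is introduced.

## References

* J. Rasmussen, *Khovanov homology and the slice genus*, Invent. Math. 182 (2010) 419–447,
  §2.2 (the filtration grading of chains and classes), Def. 3.1, §6 (proof of Thm. 1: filtered
  maps of degree `0` inducing isomorphisms preserve `s_min`, `s_max`). [cite: Rasmussen2010, §6]
* C. A. Weibel, *An introduction to homological algebra* (1994), §1.4. [folklore]
-/

open Function

noncomputable section

namespace Literature.Topology.FourManifolds

namespace GaussDiagram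

variable {G K L : GaussDiagram}

/-! ## Filtered maps of total cochains -/

/-- A linear map between total cochains is **filtered** (of degree `≥ 0` for the quantum
filtration): the image of the basis vector of an enhanced state `t` is supported on enhanced
states `s` with `qDegree t ≤ qDegree s`. Rasmussen (2010), §2.2 ("a map is filtered of degree
`k` …"). [cite: Rasmussen2010, §2.2] -/
def QFiltered (F : (G.EnhancedState → ℚ) →ₗ[ℚ] (K.EnhancedState → ℚ)) : Prop :=
  ∀ t s, F (Pi.single t 1) s ≠ 0 → qDegree t ≤ qDegree s

/-- A nonzero coefficient of the image of a chain under a filtered map comes from a state of the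
chain of lower or equal quantum degree. [folklore] -/
theorem QFiltered.exists_of_apply_ne_zero {F : (G.EnhancedState → ℚ) →ₗ[ℚ] (K.EnhancedState → ℚ)}
    (hF : QFiltered F) (w : G.EnhancedState → ℚ) (s : K.EnhancedState) (h : F w s ≠ 0) :
    ∃ t, w t ≠ 0 ∧ qDegree t ≤ qDegree s := by
  rw [KhElim.eq_sum_single w, map_sum, Finset.sum_apply] at h
  obtain ⟨t, -, ht⟩ := Finset.exists_ne_zero_of_sum_ne_zero h
  rw [map_smul, Pi.smul_apply, smul_eq_mul] at ht
  exact ⟨t, fun e ↦ ht (by rw [e, zero_mul]), hF t s fun e ↦ ht (by rw [e, mul_zero])⟩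

/-- Filtered maps compose. [folklore] -/
theorem QFiltered.comp {F : (G.EnhancedState → ℚ) →ₗ[ℚ] (K.EnhancedState → ℚ)}
    {F' : (K.EnhancedState → ℚ) →ₗ[ℚ] (L.EnhancedState → ℚ)} (hF : QFiltered F) (hF' : QFiltered F') :
    QFiltered (F' ∘ₗ F) := by
  intro t u hne
  rw [LinearMap.comp_apply] at hne
  obtain ⟨s, hs, hsu⟩ := hF'.exists_of_apply_ne_zero _ u hne
  exact (hF t s hs).trans hsu

/-- The identity is filtered. [folklore] -/
theorem QFiltered.id : QFiltered (LinearMap.id : (G.EnhancedState → ℚ) →ₗ[ℚ] (G.EnhancedState → ℚ)) := by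
  intro t s hne
  rw [LinearMap.id_apply, Pi.single_apply] at hne
  by_cases h : s = t
  · rw [h]
  · exact (hne (if_neg h)).elim

/-! ## `s_max` along a filtered homotopy equivalence -/

namespace HtpyEquiv

variable (D : HtpyEquiv ℚ G K 0 1)
  (suppF : ∀ (i : ℤ) (w : G.EnhancedState → ℚ), SuppDeg i w → SuppDeg i (D.F w))
  (suppB : ∀ (i : ℤ) (v : K.EnhancedState → ℚ), SuppDeg i v → SuppDeg i (D.B v))
  (suppHG : ∀ (i : ℤ) (w : G.EnhancedState → ℚ), SuppDeg i w → SuppDeg (i - 1) (D.HG w))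
  (suppHK : ∀ (i : ℤ) (v : K.EnhancedState → ℚ), SuppDeg i v → SuppDeg (i - 1) (D.HK v))

/-- **A filtered map does not decrease the filtration degree of degree-zero chains.**
Rasmussen (2010), §2.2. [cite: Rasmussen2010, §2.2] -/
theorem qMin_le_qMin_fDeg (hF : QFiltered D.F) (x : G.degStates 0 → ℚ) : qMin x ≤ qMin (D.fDeg 0 x) := by
  unfold qMin
  refine le_iInf₂ fun s hs ↦ ?_
  have hs' : D.F (extZero ℚ (fun u : G.EnhancedState ↦ homDegree u = 0) x) s.1 ≠ 0 := hs
  obtain ⟨t, ht, hq⟩ := hF.exists_of_apply_ne_zero _ _ hs'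
  have ht0 : homDegree t = 0 := by
    by_contra h
    exact ht (extZero_apply_of_not (p := fun u : G.EnhancedState ↦ homDegree u = 0) h x)
  have hxt : x ⟨t, ht0⟩ ≠ 0 := by
    rwa [extZero_apply_of (p := fun u : G.EnhancedState ↦ homDegree u = 0) ht0] at ht
  exact (iInf₂_le (⟨t, ht0⟩ : G.degStates 0) hxt).trans (WithBot.coe_le_coe.2 (WithTop.coe_le_coe.2 hq))

include suppF suppB suppHG in
/-- **`s_max` does not decrease along a filtered homotopy equivalence**: if the chain map
`F : C(G) → C(K)` of a degree-preserving homotopy equivalence of Lee complexes is filtered,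
then `s_max(G) ≤ s_max(K)` — `F` kills no nonzero degree-zero class (by `B F ≃ 1`) and does not
decrease `qMin` (`leeSMax_le_of_filtered`). Rasmussen (2010), §6 (proof of Thm. 1).
[cite: Rasmussen2010, §6] -/
theorem leeSMax_le_of_qFiltered (hF : QFiltered D.F) : G.leeSMax ≤ K.leeSMax := by
  let φ : G.leeCycles → K.leeCycles := fun z ↦ ⟨D.fDeg 0 z.1, by
    have hz := z.2
    rw [LinearMap.mem_ker] at hz ⊢
    rw [D.khovanovD_fDeg suppF 0 z.1, hz, map_zero]⟩
  refine leeSMax_le_of_filtered φ (fun z h0 ↦ ?_) (fun z ↦ D.qMin_le_qMin_fDeg hF z.1)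
  rw [Submodule.Quotient.mk_eq_zero, Submodule.mem_comap, LinearMap.mem_range] at h0 ⊢
  obtain ⟨y, hy⟩ := h0
  have hb := D.khovanovD_bDeg suppB (0 - 1) y
  rw [sub_add_cancel] at hb
  have hbf := D.bDeg_fDeg_sub suppF suppHG 0 z.1
  have hz : G.khovanovD ℚ 0 1 0 (0 + 1) z.1 = 0 := z.2
  rw [hz, map_zero, add_zero] at hbf
  refine ⟨D.bDeg (0 - 1) y - D.hGDeg 0 (0 - 1) z.1, ?_⟩
  rw [map_sub, hb, hy]
  show D.bDeg 0 (D.fDeg 0 z.1) - _ = z.1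
  rw [← hbf, sub_sub_cancel]

/-- The homotopy equivalence read backwards. [folklore] -/
def symm : HtpyEquiv ℚ K G 0 1 where
  F := D.B
  B := D.F
  HG := D.HK
  HK := D.HG
  F_comm := D.B_comm
  B_comm := D.F_comm
  B_F := D.F_B
  F_B := D.B_F

include suppF suppB suppHG suppHK in
/-- **`s_max` is invariant under a filtered homotopy equivalence of Lee complexes** (both chain
maps filtered, degree-preserving, homotopies lowering the homological degree by one).
Rasmussen (2010), §6 (proof of Thm. 1). [cite: Rasmussen2010, §6] -/
theorem leeSMax_eq_of_qFiltered (hF : QFiltered D.F) (hB : QFiltered D.B) : G.leeSMax = K.leeSMax :=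
  le_antisymm (D.leeSMax_le_of_qFiltered suppF suppB suppHG hF)
    (D.symm.leeSMax_le_of_qFiltered suppB suppF suppHK hB)

include suppF suppB suppHG suppHK in
/-- **Rasmussen's `s` is invariant under a filtered homotopy equivalence of Lee complexes.**
Rasmussen (2010), §6 (proof of Thm. 1), Def. 3.4. [cite: Rasmussen2010, §6] -/
theorem rasmussenInvariant_eq_of_qFiltered (hF : QFiltered D.F) (hB : QFiltered D.B) :
    G.rasmussenInvariant = K.rasmussenInvariant := by
  rw [rasmussenInvariant, rasmussenInvariant, D.leeSMax_eq_of_qFiltered suppF suppB suppHG suppHK hF hB]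

end HtpyEquiv

/-- **A strong deformation retraction is a homotopy equivalence** (with zero homotopy on the
small side). Weibel (1994), §1.4. [folklore] -/
def HtpyData.toHtpyEquiv' {R : Type} [CommRing R] {h t : R} (D : HtpyData R G K h t) : HtpyEquiv R G K h t where
  F := D.F
  B := D.B
  HG := 0
  HK := D.H
  F_comm := D.F_comm
  B_comm := D.B_comm
  B_F w := by rw [D.B_F, sub_self, LinearMap.zero_apply, LinearMap.zero_apply, map_zero, add_zero]
  F_B := D.F_B

/-- `toHtpyEquiv'`: the map `F`. [folklore] -/
@[simp] theorem HtpyData.toHtpyEquiv'_F {R : Type} [CommRing R] {h t : R} (D : HtpyData R G K h t) :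
    D.toHtpyEquiv'.F = D.F := rfl
/-- `toHtpyEquiv'`: the map `B`. [folklore] -/
@[simp] theorem HtpyData.toHtpyEquiv'_B {R : Type} [CommRing R] {h t : R} (D : HtpyData R G K h t) :
    D.toHtpyEquiv'.B = D.B := rfl
/-- `toHtpyEquiv'`: the homotopy on the big side is zero. [folklore] -/
@[simp] theorem HtpyData.toHtpyEquiv'_HG {R : Type} [CommRing R] {h t : R} (D : HtpyData R G K h t) :
    D.toHtpyEquiv'.HG = 0 := rfl
/-- `toHtpyEquiv'`: the homotopy on the small side. [folklore] -/
@[simp] theorem HtpyData.toHtpyEquiv'_HK {R : Type} [CommRing R] {h t : R} (D : HtpyData R G K h t) :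
    D.toHtpyEquiv'.HK = D.H := rfl

end GaussDiagram

end Literature.Topology.FourManifolds
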